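import Literature.NumberTheory.EllipticCurves.Kato2004.IwasawaCohomologyNumberFieldIsogeny
import HarnessLib

/-!
# Kato 2004 (Astérisque 295) §8.2 / §13.8 at level `p^k` OVER A NUMBER FIELD `K`: the reduction
# `T_pE → E[p^k]`, the levelwise reductions `H¹(U, T_pE) → H¹(U, E[p^k])` for `U ≤ Γ_K`, their tower
# compatibility, their naturality along a `K`-isogeny, and the reductions on the pinned datum
# `Kato2004.IwasawaH1DataOver` — the `K`-TWIN, word for word, of `Kato2004/IwasawaH1ReductionPk.lean`

Topic `NumberTheory/EllipticCurves`, sub-directory `Kato2004` (namespace = path).  Cell `bsd-cm`, seat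
`bsd-cm-k-ty1` g30 (literature-prover), row K2C-8 (C5) file T2a of the (C5-0) typing memo
`pub/bsd-cm/bsd-cm-k-ty1/g30/C5-typing-memo.md` (19c5e03c2b551001) — planner ruling D1019 (B) Q2 «GO NOW: T2a =
K-twin of `IwasawaH1ReductionPk`» —, crux stmt-BirchSwinnertonDyer-19945 (`EllipticUnitValueSevenOfGZK`, route K7r):
the number-field INFRASTRUCTURE under stage S5 of Kato's map (15.12.1)∘15.14 (the Λ-adic elliptic-unit class in
`H¹_Iw(Kℚ_∞/K, T_pE)` is a doubly compatible family of classes `c_{n,k} ∈ H¹(Kℚ_n, E[p^k])`; this file supplies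
the maps `red_{U,p^k}` against which «doubly compatible» is read).  Everything here is a DEFINITION WITH BODY
(two: `tateModPkK`, `reduceH1PkK`, + the method `IwasawaH1DataOver.redPk`) or a PROVED lemma; no named fact
(D-0026); no `instance`; no notation; nothing about any particular curve, about CM, or about BSD is claimed —
stmt-BirchSwinnertonDyer-19945 stays OPEN and no summit statement is proved by this file.

## The printed statements (K. Kato, Astérisque 295 (2004); store `paper:doi-10-24033-ast-639`, PDF page = printed − 115)

* **§8.2 [p. 181]** (GENERAL field of fractions `K` of an integral domain `R`): "For a finitely generated
  `ℤ_p`-module `T` endowed with a continuous action of `Gal(K̄/K)` … we denote `H^q(R, T) = lim←_n H^q(R, T/p^n)`."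
* **§13.8 [pp. 228–229]**: the change of coefficients `T → T/xT` for a non-zero-divisor `x` ("`H¹(T) →x H¹(T)`",
  "`H⁰(ℚ(ζ_{p^∞}), T/pT)`"), here `x = p^k`, `T = T_pE`, `T/p^k ≅ E[p^k]`.
* K. Rubin, *Euler Systems* (2000) App. B **Prop. B.2.3**: "`H^i(G, T) = lim← H^i(G, T/p^nT)`" — the comparison
  whose MAPS are typed here (its bijectivity over `K` is the sequel `IwasawaH1ReductionNumberFieldSeparatedProofs` /
  `IwasawaH1NumberFieldTowerLimitProofs`, files T2b of the memo).
* B. Perrin-Riou, Bull. SMF 115 (1987) §0 (p. 401): the transition maps `E[p^{k+1}] → E[p^k]` "induits par la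
  multiplication par `p`".

## Contents (mirror image of `Kato2004/IwasawaH1ReductionPk.lean` §1–§4 with `ℚ ↦ K`, `tateRep W p ↦ CM.tateRepK E p`,
`integralH1 ↦ CM.integralH1K`, `layerCores ↦ layerCoresOver`/`CM.layerCores`, `IwasawaH1Data ↦ IwasawaH1DataOver`)

* §1 `tateModPkK E p k : T_pE →+ E[p^k]`, `a = (a_n)_n ↦ a_k` (`TateModule.proj p k`), continuous and
  `Γ_K`-equivariant, for a Weierstrass curve `E` over ANY field `K`; the tower relation `(p : ℤ) • a_{k+1} = a_k`.
* §2 `reduceH1PkK E p k U : H¹(U, T_pE) → H¹(U, E[p^k])` for `U ≤ Γ_K` (`mapH1AddHom` along `tateModPkK`), its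
  cocycle formula and its compatibility with `resLe`, `coresLe`, the `K`-side trace maps `CM.layerCores` /
  `layerCoresOver`, `conjMap`, the integral classes `CM.integralH1K`, and `red_{p^k}(p^k • c) = 0`.
* §3 TOWER COMPATIBILITY `f_* ∘ red_{p^{k+1}} = red_{p^k}` for ANY additive `f : E[p^{k+1}] → E[p^k]` with
  `f P = p • P` on points (quantified, import-light, as in the ℚ-twin); and — NEW w.r.t. the twin, needed by the
  consumer's «reduction after `φ_*`» — ISOGENY NATURALITY `g_* ∘ red_{p^k} = red_{p^k} ∘ φ_*` for a `K`-isogeny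
  `φ : E → E′` and ANY additive `g : E[p^k] → E′[p^k]` agreeing with `φ` on points (`isogenyLayerMapK` of
  `IwasawaCohomologyNumberFieldIsogeny.lean`).
* §4 On the pin `IK : IwasawaH1DataOver E p κ γ`: `IK.redPk k : 𝐇¹_{K,Γ}(T_pE) → ∏_n H¹(K_n, E[p^k])`
  (norm-compatible integral values, `X` acts as `conj_γ − 1`, `p^k • x ↦ 0`).
NOT here: the level-`0` map out of the coinvariants (`redZeroPk` of the twin; the `K`-side coinvariant API is
not in the tree and no consumer asks for it); the mod-`p` (`k = 1`) dictionary with a `tateModP`-twin (use `k = 1`).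

## References
K. Kato, Astérisque 295 (2004) §8.2 (pp. 180–181), §12.2 (p. 220), §13.8 (pp. 228–229) [Kato2004Asterisque];
K. Rubin, *Euler Systems* (2000) App. B §2 Prop. B.2.3 [Rubin2000]; B. Perrin-Riou, Bull. SMF 115 (1987) §0
[PerrinRiou1987BSMF]; J.-P. Serre, *Galois Cohomology* I §2.2–2.4 [SerreGaloisCohomology1997]; tree:
`Kato2004/IwasawaH1ReductionPk.lean` (the ℚ-twin, mirrored line by line), `Kato2004/IwasawaH1Reduction.lean`
(`mapH1AddHom` and its `resLe`/`coresLe`/`conjMap` lemmas), `Kato2004/IwasawaCohomologyNumberField.lean`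
(`IwasawaH1DataOver`, `layerCoresOver`, `IsNormCompatibleOver`), `Kato2004/IwasawaCohomologyNumberFieldIsogeny.lean`
(`isogenyLayerMapK`), `Kato2004/EllipticZetaReciprocity.lean` (`CM.tateRepK`, `CM.integralH1K`, `CM.layerCores`),
`TateModule.lean` (`TateModule.proj`, `smul_proj_succ`, `pow_smul_proj`).
-/

noncomputable section

open scoped NumberField
open Field IsDedekindDomain CategoryTheory
open Literature.NumberTheory.GaloisRepresentations
open Literature.NumberTheory.EllipticCurves Literature.NumberTheory.EllipticCurves.Kato2004
open Literature.NumberTheory.EllipticCurves.Kato2004.CM (tateRepK integralH1K mem_integralH1K_iff)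
open WeierstrassCurve (geomPoints geomTorsion)

namespace Literature.NumberTheory.EllipticCurves.Kato2004

/-! ## §1 The reduction `T_pE → E[p^k]` over an arbitrary base field -/

section Reduction

variable {K : Type} [Field K] (E : WeierstrassCurve K) (p : ℕ) [Fact p.Prime] (k : ℕ)

/-- **Reduction modulo `p^k` on the Tate module of a Weierstrass curve over any field `K`**: `T_pE → E[p^k]`,
`a = (a_n)_n ↦ a_k` (the `k`-th component `TateModule.proj p k`, with values in `E(K̄)[p^k] = geomTorsion E (p^k)`).
This is the map `T → T/p^kT` (Kato §13.8 with `x = p^k`) for `T = T_pE`; the `K`-twin of `tateModPk`.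
[cite: Kato2004Asterisque, §13.8 (p. 228)] -/
def tateModPkK : E.tateModule p →+ geomTorsion E ((p : ℤ) ^ k) where
  toFun a := ⟨TateModule.proj p k a, by simpa using E.proj_tateModule_mem_geomTorsion p k a⟩
  map_zero' := Subtype.ext (map_zero _)
  map_add' a b := Subtype.ext (map_add _ a b)

omit [Fact p.Prime] in
/-- Unfolding `tateModPkK`: its value is the `k`-th component. [cite: Kato2004Asterisque, §13.8 (p. 228)] -/
@[simp]
theorem coe_tateModPkK_apply (a : E.tateModule p) :
    ((tateModPkK E p k a : geomTorsion E ((p : ℤ) ^ k)) : geomPoints E) = TateModule.proj p k a :=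
  rfl

omit [Fact p.Prime] in
/-- `tateModPkK` is continuous (the components of `T_pE` are continuous, `E[p^k]` is discrete).
[cite: Kato2004Asterisque, §13.8 (p. 228)] -/
theorem continuous_tateModPkK : Continuous (tateModPkK E p k) :=
  Continuous.subtype_mk (TateModule.continuous_proj (A := geomPoints E) (p := p) k) _

omit [Fact p.Prime] in
/-- `tateModPkK` is `Γ_K`-equivariant (the action on `T_pE` is componentwise).
[cite: Kato2004Asterisque, §13.8 (p. 228)] -/
theorem tateModPkK_smul (σ : absoluteGaloisGroup K) (a : E.tateModule p) :
    tateModPkK E p k (σ • a) = σ • tateModPkK E p k a :=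
  Subtype.ext (by
    rw [coe_tateModPkK_apply, TateModule.proj_smul_of_distribMulAction,
      AddSubgroup.torsionBy.coe_smul, coe_tateModPkK_apply])

omit [Fact p.Prime] in
/-- **The tower relation on points**: `(p : ℤ) • a_{k+1} = a_k`, i.e. the reductions modulo `p^{k+1}` and `p^k`
are compatible under multiplication by `p` (`TateModule.smul_proj_succ`). [cite: PerrinRiou1987BSMF, §0 (p. 401)] -/
theorem zsmul_coe_tateModPkK_succ (a : E.tateModule p) :
    (p : ℤ) • ((tateModPkK E p (k + 1) a : geomTorsion E ((p : ℤ) ^ (k + 1))) : geomPoints E) =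
      ((tateModPkK E p k a : geomTorsion E ((p : ℤ) ^ k)) : geomPoints E) := by
  rw [coe_tateModPkK_apply, coe_tateModPkK_apply, ← TateModule.smul_proj_succ k a, natCast_zsmul]

variable [ContinuousSMul ℤ_[p] (E.tateModule p)]

/-- Equivariance of `tateModPkK` for the restricted representations `T_pE|_U`, `E[p^k]|_U` of a subgroup
`U ≤ Γ_K` (the hypothesis shape of `mapH1AddHom`). [cite: Kato2004Asterisque, §13.8 (p. 228)] -/
theorem tateModPkK_subgroupRep (U : Subgroup (absoluteGaloisGroup K)) (u : U) (a : E.tateModule p) :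
    tateModPkK E p k ((subgroupRep (tateRepK E p).toTopRep U).ρ u a) =
      (subgroupRep (E.torsionGaloisModule ((p : ℤ) ^ k)).toTopRep U).ρ u (tateModPkK E p k a) :=
  tateModPkK_smul E p k (u : absoluteGaloisGroup K) a

/-- Equivariance of `tateModPkK` for the full representations (the hypothesis shape of `mapH1AddHom_conjMap`).
[cite: Kato2004Asterisque, §13.8 (p. 228)] -/
theorem tateModPkK_toTopRep (σ : absoluteGaloisGroup K) (a : E.tateModule p) :
    tateModPkK E p k ((tateRepK E p).toTopRep.ρ σ a) =
      (E.torsionGaloisModule ((p : ℤ) ^ k)).toTopRep.ρ σ (tateModPkK E p k a) :=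
  tateModPkK_smul E p k σ a

/-! ## §2 The levelwise reduction `H¹(U, T_pE) → H¹(U, E[p^k])` for `U ≤ Γ_K` -/

/-- **The levelwise reduction `red_{U,p^k} : H¹(U, T_pE) → H¹(U, E[p^k])`** for a subgroup `U ≤ Γ_K`
(`U = Gal(K̄/F)`: `H¹(F, T_pE) → H¹(F, E[p^k])`), induced on continuous cochains by `T_pE → E[p^k]`
(`mapH1AddHom` along `tateModPkK`).  This is the change of coefficients `T → T/p^k` (Kato §13.8; §8.2
"`H^q(R, T) = lim←_n H^q(R, T/p^n)`") at a finite level over a number field; the `K`-twin of `reduceH1Pk`.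
[cite: Kato2004Asterisque, §13.8 (pp. 228–229) and §8.2 (p. 181)] -/
def reduceH1PkK (U : Subgroup (absoluteGaloisGroup K)) :
    H1 (tateRepK E p) U →+ H1 (E.torsionGaloisModule ((p : ℤ) ^ k)) U :=
  mapH1AddHom (subgroupRep (tateRepK E p).toTopRep U)
    (subgroupRep (E.torsionGaloisModule ((p : ℤ) ^ k)).toTopRep U) (tateModPkK E p k)
    (continuous_tateModPkK E p k) (tateModPkK_subgroupRep E p k U)

/-- `reduceH1PkK` on explicit cocycles: `red [φ] = [φ mod p^k]`. [cite: Kato2004Asterisque, §13.8 (p. 228)] -/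
theorem reduceH1PkK_oneCocycleClass (U : Subgroup (absoluteGaloisGroup K))
    (φ : contOneCocycles (subgroupRep (tateRepK E p).toTopRep U)) :
    reduceH1PkK E p k U (oneCocycleClass _ φ) =
      oneCocycleClass _ (contOneCocycles.pushAddHom (tateModPkK E p k) (continuous_tateModPkK E p k)
        (tateModPkK_subgroupRep E p k U) φ) :=
  mapH1AddHom_oneCocycleClass _ _ _ φ

/-- `red_{p^k}` commutes with restriction `H¹(U', ·) → H¹(U, ·)`, `U ≤ U'`. [cite: Kato2004Asterisque, §13.8 (p. 228)] -/
theorem reduceH1PkK_resLe {U U' : Subgroup (absoluteGaloisGroup K)} (h : U ≤ U')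
    (c : H1 (tateRepK E p) U') :
    reduceH1PkK E p k U (resLe (tateRepK E p).toTopRep h 1 c) =
      resLe (E.torsionGaloisModule ((p : ℤ) ^ k)).toTopRep h 1 (reduceH1PkK E p k U' c) :=
  mapH1AddHom_resLe _ _ h _ _ c

/-- `red_{p^k}` commutes with the relative corestriction `Cor : H¹(U, ·) → H¹(U', ·)`, `U ≤ U'` open of finite
index. [cite: Kato2004Asterisque, §13.8 (p. 228)] -/
theorem reduceH1PkK_coresLe {U U' : Subgroup (absoluteGaloisGroup K)} (h : U ≤ U')
    (hU : IsOpen (U : Set (absoluteGaloisGroup K))) [hF : Fintype (U' ⧸ U.subgroupOf U')]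
    (c : H1 (tateRepK E p) U) :
    reduceH1PkK E p k U' (coresLe (tateRepK E p).toTopRep h hU c) =
      coresLe (E.torsionGaloisModule ((p : ℤ) ^ k)).toTopRep h hU (reduceH1PkK E p k U c) :=
  mapH1AddHom_coresLe (hF := hF) _ _ h hU _ _ c

/-- `red_{p^k}` commutes with the action of `σ ∈ Γ_K` on `H¹(U, ·)` for `U` normal (`conjMap`; e.g. `conj_γ` on
the layers of a `ℤ_p`-extension, through which `X ∈ Λ` acts as `conj_γ − 1`). [cite: Kato2004Asterisque, §13.8 (p. 228)] -/
theorem reduceH1PkK_conjMap (U : Subgroup (absoluteGaloisGroup K)) [U.Normal]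
    (σ : absoluteGaloisGroup K) (c : H1 (tateRepK E p) U) :
    reduceH1PkK E p k U (conjMap (tateRepK E p).toTopRep U σ 1 c) =
      conjMap (E.torsionGaloisModule ((p : ℤ) ^ k)).toTopRep U σ 1 (reduceH1PkK E p k U c) :=
  mapH1AddHom_conjMap _ _ (tateModPkK_toTopRep E p k) σ _ c

/-- **Integral classes reduce to integral classes**: `red_{p^k} (H¹(O_F[1/p], T_pE)) ⊆ H¹(O_F[1/p], E[p^k])`
(`CM.integralH1K` = classes vanishing on every inertia group away from `p`; `red` commutes with the restrictions to
`U ⊓ I_𝔓`). [cite: Kato2004Asterisque, §8.2 and Lemma 8.5 (pp. 180–184)] -/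
theorem reduceH1PkK_mem_integralH1K (U : Subgroup (absoluteGaloisGroup K)) {c : H1 (tateRepK E p) U}
    (hc : c ∈ integralH1K (tateRepK E p) p U) :
    reduceH1PkK E p k U c ∈ integralH1K (E.torsionGaloisModule ((p : ℤ) ^ k)) p U := by
  rw [mem_integralH1K_iff] at hc ⊢
  intro v hv 𝔓 h𝔓
  rw [← reduceH1PkK_resLe, hc v hv 𝔓 h𝔓, map_zero]

/-- `red_{p^k}` kills `p^k`-multiples: `red_{p^k} (p^k • c) = 0` (the coefficients `E[p^k]` are killed by `p^k`).
[cite: Kato2004Asterisque, §13.8 (p. 228)] -/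
theorem reduceH1PkK_pow_smul (U : Subgroup (absoluteGaloisGroup K)) (c : H1 (tateRepK E p) U) :
    reduceH1PkK E p k U (((p : ℤ_[p]) ^ k) • c) = 0 := by
  obtain ⟨φ, rfl⟩ := oneCocycleClass_surjective _ c
  rw [← oneCocycleClass_smul, reduceH1PkK_oneCocycleClass, oneCocycleClass_eq_zero_iff]
  refine ⟨0, fun g ↦ ?_⟩
  rw [map_zero, sub_zero, contOneCocycles.pushAddHom_apply]
  apply Subtype.ext
  rw [coe_tateModPkK_apply]
  change TateModule.proj p k ((((p : ℤ_[p]) ^ k) • φ).1 g) = 0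
  rw [Submodule.coe_smul, ContinuousMap.smul_apply, ← Nat.cast_pow, Nat.cast_smul_eq_nsmul, map_nsmul]
  exact TateModule.pow_smul_proj k (φ.1 g)

end Reduction

/-! ## §2′ The reductions and the trace maps of the `K`-side towers -/

section Traces

variable {K : Type} [Field K] [NumberField K] (E : WeierstrassCurve K) (p : ℕ) [Fact p.Prime]
  (k : ℕ) [ContinuousSMul ℤ_[p] (E.tateModule p)]

/-- `red_{p^k}` commutes with the `K`-side trace maps `Cor_{K′/K″} : H¹(K′, ·) → H¹(K″, ·)` between two layers
`U ≤ U'` (`CM.layerCores` of `EllipticZetaReciprocity.lean`, along which the elliptic units are norm-compatible).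
[cite: Kato2004Asterisque, §15.5–15.6 (p. 253) and §13.8 (p. 228)] -/
theorem reduceH1PkK_layerCores {U U' : Subgroup (absoluteGaloisGroup K)} (h : U ≤ U')
    (hU : IsOpen (U : Set (absoluteGaloisGroup K))) (c : H1 (tateRepK E p) U) :
    reduceH1PkK E p k U' (CM.layerCores (tateRepK E p) h hU c) =
      CM.layerCores (E.torsionGaloisModule ((p : ℤ) ^ k)) h hU (reduceH1PkK E p k U c) := by
  unfold CM.layerCores
  exact reduceH1PkK_coresLe E p k (hF := _) h hU c

/-- `red_{p^k}` commutes with the trace maps `Cor : H¹(K_{n+1}, ·) → H¹(K_n, ·)` of a `ℤ_p`-extension `κ` of `K`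
(`layerCoresOver`). [cite: Kato2004Asterisque, §12.2 (p. 220) and §13.8 (p. 228)] -/
theorem reduceH1PkK_layerCoresOver (κ : ZpExtension K p) (n : ℕ)
    (c : H1 (tateRepK E p) (κ.layerSubgroup (n + 1))) :
    reduceH1PkK E p k (κ.layerSubgroup n) (layerCoresOver (tateRepK E p) κ n c) =
      layerCoresOver (E.torsionGaloisModule ((p : ℤ) ^ k)) κ n
        (reduceH1PkK E p k (κ.layerSubgroup (n + 1)) c) := by
  rw [layerCoresOver_eq_layerCores, layerCoresOver_eq_layerCores]
  exact reduceH1PkK_layerCores E p k _ _ c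

end Traces

/-! ## §3 Tower compatibility `(p •)_* ∘ red_{p^{k+1}} = red_{p^k}` and naturality along a `K`-isogeny -/

section Tower

variable {K : Type} [Field K] (E : WeierstrassCurve K) (p : ℕ) [Fact p.Prime] (k : ℕ)

omit [Fact p.Prime] in
/-- A transition map `f : E[p^{k+1}] → E[p^k]` given on points by `P ↦ p • P` is `Γ_K`-equivariant for the
restricted representations of any subgroup `U ≤ Γ_K` (the Galois action commutes with multiplication by `p`).
[cite: PerrinRiou1987BSMF, §0 (p. 401)] -/
theorem transition_subgroupRepK
    (f : geomTorsion E ((p : ℤ) ^ (k + 1)) →+ geomTorsion E ((p : ℤ) ^ k))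
    (hf : ∀ P, ((f P : geomTorsion E ((p : ℤ) ^ k)) : geomPoints E) = (p : ℤ) • (P : geomPoints E))
    (U : Subgroup (absoluteGaloisGroup K)) (u : U) (P : geomTorsion E ((p : ℤ) ^ (k + 1))) :
    f ((subgroupRep (E.torsionGaloisModule ((p : ℤ) ^ (k + 1))).toTopRep U).ρ u P) =
      (subgroupRep (E.torsionGaloisModule ((p : ℤ) ^ k)).toTopRep U).ρ u (f P) := by
  apply Subtype.ext
  change ((f ((u : absoluteGaloisGroup K) • P) : geomTorsion E ((p : ℤ) ^ k)) : geomPoints E) =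
    (((u : absoluteGaloisGroup K) • f P : geomTorsion E ((p : ℤ) ^ k)) : geomPoints E)
  rw [hf, AddSubgroup.torsionBy.coe_smul, AddSubgroup.torsionBy.coe_smul, hf]
  exact (map_zsmul (DistribSMul.toAddMonoidHom (geomPoints E) (u : absoluteGaloisGroup K)) (p : ℤ)
    (P : geomPoints E)).symm

variable [ContinuousSMul ℤ_[p] (E.tateModule p)]

/-- **Tower compatibility of the reductions**: for any transition map `f : E[p^{k+1}] → E[p^k]`, `P ↦ p • P` on
points, the induced map on `H¹(U, ·)` takes `red_{p^{k+1}} c` to `red_{p^k} c` — on cocycles this is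
`p • a_{k+1} = a_k` componentwise (`zsmul_coe_tateModPkK_succ`).  So `(red_{p^k} c)_{k ≥ 1}` is a COMPATIBLE FAMILY in
`lim←_k H¹(U, E[p^k])`. [cite: PerrinRiou1987BSMF, §0 (p. 401)] [cite: Kato2004Asterisque, §13.8 (p. 228)] -/
theorem mapH1AddHom_reduceH1PkK_succ (U : Subgroup (absoluteGaloisGroup K))
    (f : geomTorsion E ((p : ℤ) ^ (k + 1)) →+ geomTorsion E ((p : ℤ) ^ k))
    (hf : ∀ P, ((f P : geomTorsion E ((p : ℤ) ^ k)) : geomPoints E) = (p : ℤ) • (P : geomPoints E))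
    (c : H1 (tateRepK E p) U) :
    mapH1AddHom (subgroupRep (E.torsionGaloisModule ((p : ℤ) ^ (k + 1))).toTopRep U)
        (subgroupRep (E.torsionGaloisModule ((p : ℤ) ^ k)).toTopRep U) f
        continuous_of_discreteTopology (transition_subgroupRepK E p k f hf U)
        (reduceH1PkK E p (k + 1) U c) =
      reduceH1PkK E p k U c := by
  obtain ⟨φ, rfl⟩ := oneCocycleClass_surjective _ c
  rw [reduceH1PkK_oneCocycleClass, reduceH1PkK_oneCocycleClass, mapH1AddHom_oneCocycleClass]
  refine congrArg _ (Subtype.ext (ContinuousMap.ext fun g ↦ Subtype.ext ?_))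
  change ((f (tateModPkK E p (k + 1) (φ.1 g)) : geomTorsion E ((p : ℤ) ^ k)) : geomPoints E) =
    ((tateModPkK E p k (φ.1 g) : geomTorsion E ((p : ℤ) ^ k)) : geomPoints E)
  rw [hf, zsmul_coe_tateModPkK_succ]

variable {E} {E' : WeierstrassCurve K} [ContinuousSMul ℤ_[p] (E'.tateModule p)]

omit [Fact p.Prime] [ContinuousSMul ℤ_[p] (E.tateModule p)] [ContinuousSMul ℤ_[p] (E'.tateModule p)] in
/-- A map `g : E[p^k] → E′[p^k]` given on points by a `K`-isogeny `φ` is `Γ_K`-equivariant for the restricted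
representations of any subgroup `U ≤ Γ_K` (`φ` is defined over `K`: `WeierstrassCurve.Isogeny.equivariant`).
[cite: SilvermanAEC2009, III §4 and III.7.4] -/
theorem isogenyTorsion_subgroupRepK (φ : WeierstrassCurve.Isogeny E E')
    (g : geomTorsion E ((p : ℤ) ^ k) →+ geomTorsion E' ((p : ℤ) ^ k))
    (hg : ∀ P, ((g P : geomTorsion E' ((p : ℤ) ^ k)) : geomPoints E') = φ (P : geomPoints E))
    (U : Subgroup (absoluteGaloisGroup K)) (u : U) (P : geomTorsion E ((p : ℤ) ^ k)) :
    g ((subgroupRep (E.torsionGaloisModule ((p : ℤ) ^ k)).toTopRep U).ρ u P) =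
      (subgroupRep (E'.torsionGaloisModule ((p : ℤ) ^ k)).toTopRep U).ρ u (g P) := by
  apply Subtype.ext
  change ((g ((u : absoluteGaloisGroup K) • P) : geomTorsion E' ((p : ℤ) ^ k)) : geomPoints E') =
    (((u : absoluteGaloisGroup K) • g P : geomTorsion E' ((p : ℤ) ^ k)) : geomPoints E')
  rw [hg, AddSubgroup.torsionBy.coe_smul, AddSubgroup.torsionBy.coe_smul, hg]
  exact φ.equivariant (u : absoluteGaloisGroup K) (P : geomPoints E)

/-- **Naturality of the reduction along a `K`-isogeny**: for `φ : E → E′` over `K` and any additive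
`g : E[p^k] → E′[p^k]` agreeing with `φ` on points, `g_* (red_{p^k} c) = red_{p^k} (φ_* c)` on `H¹(U, ·)`
(`φ_* = isogenyLayerMapK p φ U`; on cocycles: `(T_pφ a)_k = φ (a_k)`, `TateModule.proj_map`).  For an ENDOMORPHISM
`φ` of `E` this is the «reduction after `φ_*`» step of the consumer (C5) §3 (i).
[cite: Kato2004Asterisque, §13.8 (p. 228) and 15.14 (p. 264)] [cite: SilvermanAEC2009, III.7.4] -/
theorem mapH1AddHom_reduceH1PkK_isogeny (φ : WeierstrassCurve.Isogeny E E')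
    (g : geomTorsion E ((p : ℤ) ^ k) →+ geomTorsion E' ((p : ℤ) ^ k))
    (hg : ∀ P, ((g P : geomTorsion E' ((p : ℤ) ^ k)) : geomPoints E') = φ (P : geomPoints E))
    (U : Subgroup (absoluteGaloisGroup K)) (c : H1 (tateRepK E p) U) :
    mapH1AddHom (subgroupRep (E.torsionGaloisModule ((p : ℤ) ^ k)).toTopRep U)
        (subgroupRep (E'.torsionGaloisModule ((p : ℤ) ^ k)).toTopRep U) g
        continuous_of_discreteTopology (isogenyTorsion_subgroupRepK p k φ g hg U)
        (reduceH1PkK E p k U c) =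
      reduceH1PkK E' p k U (isogenyLayerMapK p φ U c) := by
  obtain ⟨θ, rfl⟩ := oneCocycleClass_surjective _ c
  rw [reduceH1PkK_oneCocycleClass, mapH1AddHom_oneCocycleClass, isogenyLayerMapK_oneCocycleClass,
    reduceH1PkK_oneCocycleClass]
  refine congrArg _ (Subtype.ext (ContinuousMap.ext fun u ↦ Subtype.ext ?_))
  change ((g (tateModPkK E p k (θ.1 u)) : geomTorsion E' ((p : ℤ) ^ k)) : geomPoints E') =
    ((tateModPkK E' p k (TateModule.map p φ.toAddMonoidHom (θ.1 u)) : geomTorsion E' ((p : ℤ) ^ k)) :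
      geomPoints E')
  rw [hg, coe_tateModPkK_apply, coe_tateModPkK_apply, TateModule.proj_map]
  rfl

end Tower

/-! ## §4 The reductions on the pinned datum `𝐇¹_{K,Γ}(T_pE)` -/

namespace IwasawaH1DataOver

variable {K : Type} [Field K] {E : WeierstrassCurve K} {p : ℕ} [Fact p.Prime]
  [ContinuousSMul ℤ_[p] (E.tateModule p)] {κ : ZpExtension K p} {γ : absoluteGaloisGroup K}
  (IK : IwasawaH1DataOver E p κ γ) (k : ℕ)

/-- **The reduction `red_{p^k} : 𝐇¹_{K,Γ}(T_pE) → lim←_n H¹(K_n, E[p^k])`** on the pinned datum, written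
levelwise inside `∏_n H¹(K_n, E[p^k])`: `x ↦ (red_{p^k} (proj n x))_n` (the `K`-twin of `IwasawaH1Data.redPk`).
Values are norm-compatible integral families (`redPk_mem_normCompatibleOver`).
[cite: Kato2004Asterisque, §13.8 (pp. 228–229) with §12.2 (p. 220)] -/
def redPk : IK.H →+ ∀ n : ℕ, H1 (E.torsionGaloisModule ((p : ℤ) ^ k)) (κ.layerSubgroup n) where
  toFun x n := reduceH1PkK E p k (κ.layerSubgroup n) (IK.proj n x)
  map_zero' := funext fun n ↦ by rw [map_zero, map_zero]; rfl
  map_add' x y := funext fun n ↦ by rw [map_add, map_add]; rfl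

/-- Unfolding `redPk`: its `n`-th component is `red_{p^k} (proj n x)`. [cite: Kato2004Asterisque, §13.8 (p. 228)] -/
@[simp]
theorem redPk_apply (x : IK.H) (n : ℕ) :
    IK.redPk k x n = reduceH1PkK E p k (κ.layerSubgroup n) (IK.proj n x) :=
  rfl

/-- The mod-`p^k` reduction of an element of `𝐇¹_{K,Γ}(T_pE)` is a norm-compatible integral family of
`∏_n H¹(K_n, E[p^k])` (`proj_mem`, `cores_proj` of the pin and `reduceH1PkK_mem_integralH1K`,
`reduceH1PkK_layerCoresOver`). [cite: Kato2004Asterisque, §12.2 (p. 220) and §13.8 (p. 228)] -/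
theorem isNormCompatibleOver_redPk [NumberField K] (x : IK.H) :
    IsNormCompatibleOver (E.torsionGaloisModule ((p : ℤ) ^ k)) κ (IK.redPk k x) := by
  refine ⟨fun n ↦ ?_, fun n ↦ ?_⟩
  · rw [redPk_apply]
    exact reduceH1PkK_mem_integralH1K E p k _ (IK.proj_mem n x)
  · rw [redPk_apply, redPk_apply, ← reduceH1PkK_layerCoresOver, IK.cores_proj n x]

/-- `redPk k x ∈ normCompatibleOver (E.torsionGaloisModule (p^k)) κ = lim←_n H¹(O_{K_n}[1/p], E[p^k])`.
[cite: Kato2004Asterisque, §12.2 (p. 220) and §13.8 (p. 228)] -/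
theorem redPk_mem_normCompatibleOver [NumberField K] (x : IK.H) :
    IK.redPk k x ∈ normCompatibleOver (E.torsionGaloisModule ((p : ℤ) ^ k)) κ :=
  IK.isNormCompatibleOver_redPk k x

/-- **`red_{p^k}` is semilinear for `X`**: `red_{p^k} (X • x) = (conj_γ − 1) (red_{p^k} x)` levelwise
(`proj_T_smul` of the pin and `reduceH1PkK_conjMap`). [cite: Kato2004Asterisque, §13.8 (p. 228)] -/
theorem redPk_X_smul (x : IK.H) (n : ℕ) :
    IK.redPk k ((PowerSeries.X : IwasawaAlgebra p) • x) n =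
      conjMap (E.torsionGaloisModule ((p : ℤ) ^ k)).toTopRep (κ.layerSubgroup n) γ 1 (IK.redPk k x n) -
        IK.redPk k x n := by
  rw [redPk_apply, IK.proj_T_smul n x, map_sub, reduceH1PkK_conjMap, redPk_apply]

/-- Constants of `Λ` reduce through `ℤ_p → ℤ/p^k`: in particular `red_{p^k} (p^k • x) = 0`
(`proj_C_smul` and `reduceH1PkK_pow_smul`). [cite: Kato2004Asterisque, §13.8 (p. 228)] -/
theorem redPk_C_pow_smul (x : IK.H) :
    IK.redPk k (PowerSeries.C ((p : ℤ_[p]) ^ k) • x) = 0 := by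
  funext n
  rw [redPk_apply, IK.proj_C_smul, reduceH1PkK_pow_smul]
  rfl

end IwasawaH1DataOver

end Literature.NumberTheory.EllipticCurves.Kato2004

end
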